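import Literature.Barriers.AtomisticToContinuum.HardDiskDeformation
import Literature.Analysis.FunctionSpaces.PointConfigKernel
import Mathlib.MeasureTheory.Constructions.BorelSpace.Real
import Mathlib.MeasureTheory.Constructions.BorelSpace.Order
import HarnessLib

/-!
# Measurability of Richthammer's generalised translation in coordinates (Richthammer 2007, §5.4,
# "Using Lemma 6 one can show that all above objects are measurable")

Sequel to `HardDiskDeformation.lean` (provefact `Richthammer2007_ineq35`, the concrete
translation systems for `ShearCells.Admissible`). Richthammer disposes of measurability by the
list of measurability-preserving operations of Lemma 6 [Richthammer2007, §3.6 and §5.4, p. 11: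
"Using Lemma 6 one can show that all above objects are measurable with respect to the considered
σ-algebras"]. Here, for the coordinate version along a forced selection order, everything is a
finite recursion of continuous functions, countable infima (over the points of the boundary
condition outside `Λ_n`) and measurable case distinctions, and we prove:

* `continuous_prof`, `measurable_mAux` (jointly in `(x', t, x)`), `measurable_outShift`;
* `stagePairs_eq_map_range` — the recursion unrolled: the earlier pairs are
  `(p_i, τ_i)_{i<s}` with `τ_i = stageTau … i`;
* `measurable_stageTau`, **`measurable_richtShift`** — the translation system
  `richtShift P Y k π l` is a measurable function of the thrown points (the hypothesis
  `measurable_shift` of `ShearCells.Admissible`).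

Standing hypotheses `0 ≤ τ` and `R < n` (continuity of `τ_n` is taken from the tree's Lipschitz
estimate `abs_tProfile_sub_le`).

## References

* [Richthammer2007] T. Richthammer, *Translation-invariance of two-dimensional Gibbsian point
  processes*, Comm. Math. Phys. 274 (2007) 81–122, arXiv:0706.3637: §3.6 Lemma 6 (p. 8), §5.4
  (p. 11).
-/

noncomputable section

open MeasureTheory Set Function
open scoped ENNReal

namespace Literature.Barriers.AtomisticToContinuum.HardDisk

open Literature.Analysis.FunctionSpaces

namespace DeformData

variable {P : DeformData}

/-! ### Continuity and measurability of the elementary functions -/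

/-- `τ_n` is continuous (it is Lipschitz, (6.15)). [cite: Richthammer2007, §6.8 (6.15) (p. 17)] -/
theorem continuous_prof (hτ : 0 ≤ P.τ) (hRn : P.R < P.n) : Continuous P.prof := by
  have hRn' : (P.R : ℝ) < P.n := by exact_mod_cast hRn
  have hQ : 0 < QFun ((P.n : ℝ) - P.R) := QFun_pos (sub_pos.2 hRn')
  refine Metric.continuous_iff.2 fun s ε hε => ?_
  refine ⟨ε * QFun ((P.n : ℝ) - P.R) / (P.τ + 1), by positivity, fun s' hs' => ?_⟩
  rw [Real.dist_eq] at hs' ⊢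
  calc |P.prof s' - P.prof s| ≤ P.τ * |s' - s| / QFun ((P.n : ℝ) - P.R) :=
        abs_tProfile_sub_le hτ hRn' s' s
    _ < P.τ * (ε * QFun ((P.n : ℝ) - P.R) / (P.τ + 1)) / QFun ((P.n : ℝ) - P.R) + ε / (P.τ + 1) := by
        have h1 : P.τ * |s' - s| / QFun ((P.n : ℝ) - P.R) ≤
            P.τ * (ε * QFun ((P.n : ℝ) - P.R) / (P.τ + 1)) / QFun ((P.n : ℝ) - P.R) :=
          div_le_div_of_nonneg_right (mul_le_mul_of_nonneg_left hs'.le hτ) hQ.le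
        have h2 : 0 < ε / (P.τ + 1) := by positivity
        linarith
    _ = ε := by field_simp

/-- `t⁰ = τ_n(|·|)` is continuous. [cite: Richthammer2007, §5.4 (p. 11)] -/
theorem continuous_baseShift (hτ : 0 ≤ P.τ) (hRn : P.R < P.n) : Continuous P.baseShift :=
  (continuous_prof hτ hRn).comp continuous_supNorm

/-- `h_{x',t}` is continuous in `(x', t)`. [cite: Richthammer2007, §5.4 (p. 11)] -/
theorem continuous_hAux (hτ : 0 ≤ P.τ) (hRn : P.R < P.n) :
    Continuous fun p : EuclideanSpace ℝ (Fin 2) × ℝ => P.hAux p.1 p.2 := by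
  unfold hAux
  exact (((continuous_prof hτ hRn).comp ((continuous_supNorm.comp continuous_fst).sub
    continuous_const)).sub continuous_snd).abs

/-- **`m_{x',t}(x)` is jointly measurable in `(x', t, x)`** (a measurable case distinction
between continuous functions). [cite: Richthammer2007, §5.4 (p. 11) with §3.6 Lemma 6] -/
theorem measurable_mAux (hτ : 0 ≤ P.τ) (hRn : P.R < P.n) :
    Measurable fun p : EuclideanSpace ℝ (Fin 2) × ℝ × EuclideanSpace ℝ (Fin 2) =>
      P.mAux p.1 p.2.1 p.2.2 := by
  have h1 : Measurable fun p : EuclideanSpace ℝ (Fin 2) × ℝ × EuclideanSpace ℝ (Fin 2) =>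
      ((p.1, p.2.1) : EuclideanSpace ℝ (Fin 2) × ℝ) :=
    measurable_fst.prodMk (measurable_fst.comp measurable_snd)
  have hhm : Measurable fun q : EuclideanSpace ℝ (Fin 2) × ℝ => P.hAux q.1 q.2 :=
    (continuous_hAux hτ hRn).measurable
  have hh' := hhm.comp h1
  have hh : Measurable fun p : EuclideanSpace ℝ (Fin 2) × ℝ × EuclideanSpace ℝ (Fin 2) =>
      P.hAux p.1 p.2.1 := hh'
  have h2 : Measurable fun p : EuclideanSpace ℝ (Fin 2) × ℝ × EuclideanSpace ℝ (Fin 2) =>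
      p.2.2 - p.1 := (measurable_snd.comp measurable_snd).sub measurable_fst
  have hf' := (continuous_fK P.ε).measurable.comp h2
  have hf : Measurable fun p : EuclideanSpace ℝ (Fin 2) × ℝ × EuclideanSpace ℝ (Fin 2) =>
      fK P.ε (p.2.2 - p.1) := hf'
  have htr : Measurable fun p : EuclideanSpace ℝ (Fin 2) × ℝ × EuclideanSpace ℝ (Fin 2) => p.2.1 :=
    measurable_fst.comp measurable_snd
  have ht : Measurable fun p : EuclideanSpace ℝ (Fin 2) × ℝ × EuclideanSpace ℝ (Fin 2) =>
      ((p.2.1 : ℝ) : EReal) := measurable_coe_real_ereal.comp htr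
  have hsum : Measurable fun p : EuclideanSpace ℝ (Fin 2) × ℝ × EuclideanSpace ℝ (Fin 2) =>
      p.2.1 + P.hAux p.1 p.2.1 * fK P.ε (p.2.2 - p.1) := htr.add (hh.mul hf)
  have hsum' : Measurable fun p : EuclideanSpace ℝ (Fin 2) × ℝ × EuclideanSpace ℝ (Fin 2) =>
      ((p.2.1 + P.hAux p.1 p.2.1 * fK P.ε (p.2.2 - p.1) : ℝ) : EReal) :=
    measurable_coe_real_ereal.comp hsum
  have hc1 : MeasurableSet {p : EuclideanSpace ℝ (Fin 2) × ℝ × EuclideanSpace ℝ (Fin 2) |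
      1 / 2 < P.hAux p.1 p.2.1 * cF P.ε} := measurableSet_lt measurable_const (hh.mul_const _)
  have hc2 : MeasurableSet {p : EuclideanSpace ℝ (Fin 2) × ℝ × EuclideanSpace ℝ (Fin 2) |
      fK P.ε (p.2.2 - p.1) = 1} := measurableSet_eq_fun hf measurable_const
  unfold mAux
  exact Measurable.ite hc1 ht (Measurable.ite hc2 measurable_const hsum')

/-- For fixed `(x', t)`, `m_{x',t}` is measurable. [cite: Richthammer2007, §5.4 (p. 11)] -/
theorem measurable_mAux_right (hτ : 0 ≤ P.τ) (hRn : P.R < P.n) (x' : EuclideanSpace ℝ (Fin 2)) (t : ℝ) :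
    Measurable (P.mAux x' t) := by
  have h1 : Measurable fun y : EuclideanSpace ℝ (Fin 2) =>
      ((x', t, y) : EuclideanSpace ℝ (Fin 2) × ℝ × EuclideanSpace ℝ (Fin 2)) :=
    measurable_const.prodMk (measurable_const.prodMk measurable_id)
  have h := (measurable_mAux hτ hRn).comp h1
  exact h

/-- The points of the boundary condition outside `Λ_n` form a countable index set. [folklore] -/
theorem countable_outside (P : DeformData) (Y : PointConfig (EuclideanSpace ℝ (Fin 2))) :
    Countable {q : EuclideanSpace ℝ (Fin 2) // q ∈ Y ∧ q ∉ box (P.n : ℝ)} := by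
  have h : Set.Countable {q : EuclideanSpace ℝ (Fin 2) | q ∈ Y ∧ q ∉ box (P.n : ℝ)} :=
    Y.countable_carrier.mono fun q hq => hq.1
  exact h.to_subtype

/-- **`m_{p⁰,τ⁰}` is measurable** (a countable infimum). [cite: Richthammer2007, §5.4 (p. 11) with §3.6 Lemma 6] -/
theorem measurable_outShift (hτ : 0 ≤ P.τ) (hRn : P.R < P.n) (Y : PointConfig (EuclideanSpace ℝ (Fin 2))) :
    Measurable (P.outShift Y) := by
  haveI := countable_outside P Y
  unfold outShift
  have h := Measurable.iInf fun q : {q : EuclideanSpace ℝ (Fin 2) // q ∈ Y ∧ q ∉ box (P.n : ℝ)} =>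
    measurable_mAux_right hτ hRn q.1 0
  exact h

/-- The constraints of a list of pairs given by measurable functions are measurable, jointly in
the argument. [folklore] -/
theorem measurable_listShift_map {α : Type*} [MeasurableSpace α] (hτ : 0 ≤ P.τ) (hRn : P.R < P.n)
    (fs : List ((α → EuclideanSpace ℝ (Fin 2)) × (α → ℝ)))
    (hfs : ∀ fg ∈ fs, Measurable fg.1 ∧ Measurable fg.2)
    {y : α → EuclideanSpace ℝ (Fin 2)} (hy : Measurable y) :
    Measurable fun a => P.listShift (fs.map fun fg => (fg.1 a, fg.2 a)) (y a) := by
  induction fs with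
  | nil =>
    simp only [List.map_nil, listShift, List.foldr_nil]
    exact measurable_const
  | cons fg rest ih =>
    have hfg := hfs fg List.mem_cons_self
    have ih' := ih fun fg' h' => hfs fg' (List.mem_cons_of_mem _ h')
    simp only [List.map_cons, listShift, List.foldr_cons] at ih' ⊢
    have h1 : Measurable fun a : α =>
        ((fg.1 a, fg.2 a, y a) : EuclideanSpace ℝ (Fin 2) × ℝ × EuclideanSpace ℝ (Fin 2)) :=
      hfg.1.prodMk (hfg.2.prodMk hy)
    have h2' := (measurable_mAux hτ hRn).comp h1
    have h2 : Measurable fun a : α => P.mAux (fg.1 a) (fg.2 a) (y a) := h2'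
    exact Measurable.min h2 ih'

/-! ### The recursion unrolled -/

variable (P) in
/-- **The recursion unrolled**: the pairs of the stages `< s` are `(p_i, τ_i)`, `i < s`, with
`τ_i = stageTau Y p i`. [cite: Richthammer2007, §5.4 (p. 11)] -/
theorem stagePairs_eq_map_range (Y : PointConfig (EuclideanSpace ℝ (Fin 2)))
    (p : ℕ → EuclideanSpace ℝ (Fin 2)) (s : ℕ) :
    P.stagePairs Y p s = (List.range s).map fun i => (p i, P.stageTau Y p i) := by
  induction s with
  | zero => rfl
  | succ s ih =>
    rw [List.range_succ, List.map_append, List.map_singleton, ← ih]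
    rfl

/-- The positions in selection order are measurable functions of the thrown points. [folklore] -/
theorem measurable_posSeq {k : ℕ} (π : Equiv.Perm (Fin k)) (s : ℕ) :
    Measurable fun x : Fin k → EuclideanSpace ℝ (Fin 2) => posSeq π x s := by
  unfold posSeq
  split_ifs with h
  · exact measurable_pi_apply _
  · exact measurable_const

variable (P) in
/-- `t^{s+1}` of a stage, as the real part of the explicit infimum. [cite: Richthammer2007, §5.4 (p. 11)] -/
theorem stageShift_eq (Y : PointConfig (EuclideanSpace ℝ (Fin 2)))
    (earlier : List (EuclideanSpace ℝ (Fin 2) × ℝ)) (y : EuclideanSpace ℝ (Fin 2)) :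
    P.stageShift Y earlier y =
      ((P.baseShift y : EReal) ⊓ P.outShift Y y ⊓ P.listShift earlier y).toReal := rfl

/-- **Measurability of the recursion**: `x ↦ τ_s(x)` (the translation of the particle selected
at stage `s`) is measurable. [cite: Richthammer2007, §5.4 (p. 11) with §3.6 Lemma 6] -/
theorem measurable_stageTau (hτ : 0 ≤ P.τ) (hRn : P.R < P.n) (Y : PointConfig (EuclideanSpace ℝ (Fin 2)))
    {k : ℕ} (π : Equiv.Perm (Fin k)) (s : ℕ) :
    Measurable fun x : Fin k → EuclideanSpace ℝ (Fin 2) => P.stageTau Y (posSeq π x) s := by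
  induction s using Nat.strong_induction_on with
  | _ s ih =>
    have heq : (fun x : Fin k → EuclideanSpace ℝ (Fin 2) => P.stageTau Y (posSeq π x) s) =
        fun x => ((P.baseShift (posSeq π x s) : EReal) ⊓ P.outShift Y (posSeq π x s) ⊓
          P.listShift (((List.range s).map fun i =>
            ((fun x : Fin k → EuclideanSpace ℝ (Fin 2) => posSeq π x i),
              (fun x : Fin k → EuclideanSpace ℝ (Fin 2) => P.stageTau Y (posSeq π x) i))).map
            fun fg => (fg.1 x, fg.2 x)) (posSeq π x s)).toReal := by
      funext x
      rw [stageTau, stageShift_eq, stagePairs_eq_map_range, List.map_map]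
      rfl
    rw [heq]
    have hb' := (continuous_baseShift hτ hRn).measurable.comp (measurable_posSeq π s)
    have hb'' := measurable_coe_real_ereal.comp hb'
    have hb : Measurable fun x : Fin k → EuclideanSpace ℝ (Fin 2) =>
        ((P.baseShift (posSeq π x s) : ℝ) : EReal) := hb''
    have ho' := (measurable_outShift hτ hRn Y).comp (measurable_posSeq π s)
    have ho : Measurable fun x : Fin k → EuclideanSpace ℝ (Fin 2) =>
        P.outShift Y (posSeq π x s) := ho'
    have hl := measurable_listShift_map hτ hRn ((List.range s).map fun i =>
        ((fun x : Fin k → EuclideanSpace ℝ (Fin 2) => posSeq π x i),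
          (fun x : Fin k → EuclideanSpace ℝ (Fin 2) => P.stageTau Y (posSeq π x) i)))
      (fun fg hfg => by
        simp only [List.mem_map, List.mem_range] at hfg
        obtain ⟨i, hi, rfl⟩ := hfg
        exact ⟨measurable_posSeq π i, ih i hi⟩) (measurable_posSeq π s)
    exact Measurable.ereal_toReal (Measurable.min (Measurable.min hb ho) hl)

/-- **The translation system is measurable**: `richtShift P Y k π l` is a measurable function of
the thrown points (the hypothesis `measurable_shift` of `ShearCells.Admissible`).
[cite: Richthammer2007, §5.4 (p. 11) with §3.6 Lemma 6] -/
theorem measurable_richtShift (hτ : 0 ≤ P.τ) (hRn : P.R < P.n) (Y : PointConfig (EuclideanSpace ℝ (Fin 2)))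
    (k : ℕ) (π : Equiv.Perm (Fin k)) (l : Fin k) :
    Measurable (P.richtShift Y k π l) := by
  have heq : P.richtShift Y k π l =
      fun x => ((P.baseShift (x l) : EReal) ⊓ P.outShift Y (x l) ⊓
        P.listShift (((List.range (stageOf π l)).map fun i =>
          ((fun x : Fin k → EuclideanSpace ℝ (Fin 2) => posSeq π x i),
            (fun x : Fin k → EuclideanSpace ℝ (Fin 2) => P.stageTau Y (posSeq π x) i))).map
          fun fg => (fg.1 x, fg.2 x)) (x l)).toReal := by
    funext x
    rw [richtShift, stageShift_eq, stagePairs_eq_map_range, List.map_map]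
    rfl
  rw [heq]
  have hb' := (continuous_baseShift hτ hRn).measurable.comp
    (measurable_pi_apply (X := fun _ : Fin k => EuclideanSpace ℝ (Fin 2)) l)
  have hb'' := measurable_coe_real_ereal.comp hb'
  have hb : Measurable fun x : Fin k → EuclideanSpace ℝ (Fin 2) => ((P.baseShift (x l) : ℝ) : EReal) := hb''
  have ho' := (measurable_outShift hτ hRn Y).comp
    (measurable_pi_apply (X := fun _ : Fin k => EuclideanSpace ℝ (Fin 2)) l)
  have ho : Measurable fun x : Fin k → EuclideanSpace ℝ (Fin 2) => P.outShift Y (x l) := ho'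
  have hl := measurable_listShift_map hτ hRn ((List.range (stageOf π l)).map fun i =>
      ((fun x : Fin k → EuclideanSpace ℝ (Fin 2) => posSeq π x i),
        (fun x : Fin k → EuclideanSpace ℝ (Fin 2) => P.stageTau Y (posSeq π x) i)))
    (fun fg hfg => by
      simp only [List.mem_map, List.mem_range] at hfg
      obtain ⟨i, _, rfl⟩ := hfg
      exact ⟨measurable_posSeq π i, measurable_stageTau hτ hRn Y π i⟩)
    (measurable_pi_apply (X := fun _ : Fin k => EuclideanSpace ℝ (Fin 2)) l)
  exact Measurable.ereal_toReal (Measurable.min (Measurable.min hb ho) hl)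

end DeformData

end Literature.Barriers.AtomisticToContinuum.HardDisk

end
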